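import Literature.NumberTheory.LFunctions.KadiriZeroSum
import Literature.NumberTheory.LFunctions.KadiriThirdOrderRemainder
import HarnessLib

/-!
# Kadiri's lower bound for the sum over the zeros, with the third-order far-zero remainder

Topic `Literature/NumberTheory/LFunctions`. Everything in this file is PROVED (no definition, no
named fact). This is the companion of `KadiriZeroSum.lean` (Kadiri, Acta Arith. 117 (2005), §4.1:
Props. 4.2, 4.4 ⇒ Props. 2.5–2.7) in which the remainder `H(x, y)` of Lemma 3.2 attached to the
zeros at distance `|γ − t| ≥ t₀` from the point `σ + it` is bounded by the THIRD-order form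
`|H| ≤ M₃(x/η) η³/|x + iy|³ ≤ (M₃ η/t₀) η²/y²` (`KadiriThird.abs_H_le`,
`KadiriThirdOrderRemainder.lean`) instead of `M(x/η) η²/y²`: the statements are those of
`KadiriZeroSum.far_pair_ge`, `pairVal_far_ge`, `lower_bound_kept`, `lower_bound` verbatim, with the
hypothesis `M(x/η) ≤ M*` (`x ≥ σ − 1`) replaced by `M₃(x/η) η ≤ M* t₀` (`x ≥ σ − 1`), and the proofs
are the same bookkeeping. With this form the constant `M*` is of size `M₃(−r/R) η₀/t₀`, so that
Kadiri's method can be run with a small splitting height `t₀` (in the tree: `t₀ = 101`, the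
height to which the Riemann hypothesis is PROVED in the tree, `riemannHypothesisUpTo_hundredOne`),
which is what makes the large-height region of Mossinghoff–Trudgian–Yang unconditional in the tree
(`KadiriStripEmptiness3.lean`).

## References

* H. Kadiri, *Une région explicite sans zéros pour la fonction ζ de Riemann*, Acta Arith. 117
  (2005) = arXiv:math/0401238, §2.4–2.5, §4.1 (Props. 4.2, 4.4, 4.6), (3.10)–(3.11), Lemma 3.2.
  [Kadiri2005]
* M. J. Mossinghoff, T. S. Trudgian, J. Number Theory 157 (2015) = arXiv:1410.3926, §4.3 (`C₃`).
  [MossinghoffTrudgian2015]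
-/

noncomputable section

open Complex Real MeasureTheory Set
open scoped ComplexConjugate

namespace Literature.NumberTheory.LFunctions

namespace KadiriZeroSum3

open FordL33 NicolasJExplicit

variable {θ η : ℝ}

/-- **Lower bound for a far pair, third-order remainder** ((3.11) and the proof of Prop. 4.4): for
`0 ≤ β ≤ 1`, `|y| ≥ t₀ ≥ 1`, under the Stechkin condition at `(p₀, t₀) = (−(1−σ), t₀)` and
`M₃(x/η) η ≤ M* t₀` for `x ≥ σ − 1` (`M₃ = mtyM3 θ`, `KadiriThirdOrderRemainder.lean`),
`[F̃(σ−β,y) + F̃(σ−1+β,y)] − κ[F̃(σ+δ−β,y) + F̃(σ+δ−1+β,y)] ≥ −2(1+κ) M* η²/y²`.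
[cite: Kadiri2005, Prop. 4.4] -/
theorem far_pair_ge (hθ : 0 < θ) (hθ' : θ < π / 2) (hη : 0 < η) {σ δ κ t₀ Mst β y : ℝ}
    (hσ : 1 / 2 < σ) (hσ1 : σ ≤ 1) (hδ : 0 ≤ δ) (hδσ : 2 * (1 - σ) ≤ δ) (hκ : 0 ≤ κ) (ht₀ : 1 ≤ t₀)
    (hβ0 : 0 ≤ β) (hβ1 : β ≤ 1) (hy : t₀ ≤ |y|)
    (hA : κ * (2 * σ - 1 + 2 * δ) ≤ 2 * σ - 1)
    (hSt : κ * (2 * σ - 1 + 2 * δ) * (-(1 - σ) + (2 * σ - 1) * δ + δ ^ 2 + t₀ ^ 2) ≤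
      (2 * σ - 1) * (-(1 - σ) + t₀ ^ 2))
    (hM : ∀ x : ℝ, σ - 1 ≤ x → mtyM3 θ (x / η) * η ≤ Mst * t₀) :
    -(2 * (1 + κ) * Mst * η ^ 2 / y ^ 2) ≤
      ((fordLaplace (kadiriTest θ η) (((σ - β : ℝ) : ℂ) + y * I)).re +
          (fordLaplace (kadiriTest θ η) (((σ - 1 + β : ℝ) : ℂ) + y * I)).re) -
        κ * ((fordLaplace (kadiriTest θ η) (((σ + δ - β : ℝ) : ℂ) + y * I)).re +
          (fordLaplace (kadiriTest θ η) (((σ + δ - 1 + β : ℝ) : ℂ) + y * I)).re) := by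
  have hg0 : 0 < fordSmoothW0 θ := fordSmoothW0_pos hθ hθ'
  have hy0 : y ≠ 0 := fun h ↦ by rw [h, abs_zero] at hy; linarith
  have ht₀pos : 0 < t₀ := by linarith
  have hy2 : 0 < y ^ 2 := by positivity
  set x₁ : ℝ := σ - β with hx₁
  set x₂ : ℝ := σ - 1 + β with hx₂
  set E : ℝ := Mst * η ^ 2 / y ^ 2 with hE
  -- the four `H`-bounds
  have b1 := (abs_le.1 (KadiriThird.abs_H_le hθ hθ' hη (x := x₁) ht₀pos hy (hM x₁ (by rw [hx₁]; linarith)))).1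
  have b2 := (abs_le.1 (KadiriThird.abs_H_le hθ hθ' hη (x := x₂) ht₀pos hy (hM x₂ (by rw [hx₂]; linarith)))).1
  have b3 := (abs_le.1 (KadiriThird.abs_H_le hθ hθ' hη (x := x₁ + δ) ht₀pos hy (hM (x₁ + δ) (by rw [hx₁]; linarith)))).2
  have b4 := (abs_le.1 (KadiriThird.abs_H_le hθ hθ' hη (x := x₂ + δ) ht₀pos hy (hM (x₂ + δ) (by rw [hx₂]; linarith)))).2
  rw [← hE] at b1 b2 b3 b4
  -- the Stechkin main term
  have ha : x₁ + x₂ = 2 * σ - 1 := by rw [hx₁, hx₂]; ring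
  have hA' : κ * (x₁ + x₂ + 2 * δ) ≤ x₁ + x₂ := by rw [ha]; exact hA
  have hSt' : κ * (x₁ + x₂ + 2 * δ) * (-(1 - σ) + (x₁ + x₂) * δ + δ ^ 2 + t₀ ^ 2) ≤
      (x₁ + x₂) * (-(1 - σ) + t₀ ^ 2) := by rw [ha]; exact hSt
  have hp0 : 0 < -(1 - σ) + t₀ ^ 2 := by nlinarith
  have hS := KadiriStechkin.fourTerm_nonneg_of_ratio_ge (x₁ := x₁) (x₂ := x₂) (δ := δ) (κ := κ)
    (y := y) (y₀ := t₀) (p₀ := -(1 - σ)) (by rw [ha]; linarith) (by rw [hx₁]; linarith)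
    (by rw [hx₂]; linarith) hδ hκ (by linarith) hy
    (by rw [hx₁, hx₂]; exact KadiriZeroSum.prod_ge hβ0 hβ1 hσ1) hp0 hA' hSt'
  simp only [KadiriStechkin.re_inv_eq] at hS
  have hmain : 0 ≤ η * fordSmoothW0 θ * (x₁ / (x₁ ^ 2 + y ^ 2) + x₂ / (x₂ ^ 2 + y ^ 2) -
      κ * ((x₁ + δ) / ((x₁ + δ) ^ 2 + y ^ 2) + (x₂ + δ) / ((x₂ + δ) ^ 2 + y ^ 2))) :=
    mul_nonneg (by positivity) hS
  -- rewrite the four `F̃` in terms of main terms and `H`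
  have e1 : ((σ + δ - β : ℝ) : ℂ) = (((x₁ + δ : ℝ)) : ℂ) := by rw [hx₁]; push_cast; ring
  have e2 : ((σ + δ - 1 + β : ℝ) : ℂ) = (((x₂ + δ : ℝ)) : ℂ) := by rw [hx₂]; push_cast; ring
  have hxcast₁ : (((σ - β : ℝ)) : ℂ) = (x₁ : ℂ) := by rw [hx₁]
  have hxcast₂ : (((σ - 1 + β : ℝ)) : ℂ) = (x₂ : ℂ) := by rw [hx₂]
  rw [e1, e2, hxcast₁, hxcast₂]
  -- name the four values and the four main terms
  set F₁ := (fordLaplace (kadiriTest θ η) ((x₁ : ℂ) + y * I)).re with hF₁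
  set F₂ := (fordLaplace (kadiriTest θ η) ((x₂ : ℂ) + y * I)).re with hF₂
  set F₃ := (fordLaplace (kadiriTest θ η) (((x₁ + δ : ℝ) : ℂ) + y * I)).re with hF₃
  set F₄ := (fordLaplace (kadiriTest θ η) (((x₂ + δ : ℝ) : ℂ) + y * I)).re with hF₄
  have key : (F₁ + F₂) - κ * (F₃ + F₄)
      = η * fordSmoothW0 θ * (x₁ / (x₁ ^ 2 + y ^ 2) + x₂ / (x₂ ^ 2 + y ^ 2) -
          κ * ((x₁ + δ) / ((x₁ + δ) ^ 2 + y ^ 2) + (x₂ + δ) / ((x₂ + δ) ^ 2 + y ^ 2)))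
        + ((F₁ - η * fordSmoothW0 θ * x₁ / (x₁ ^ 2 + y ^ 2))
          + (F₂ - η * fordSmoothW0 θ * x₂ / (x₂ ^ 2 + y ^ 2))
          - κ * ((F₃ - η * fordSmoothW0 θ * (x₁ + δ) / ((x₁ + δ) ^ 2 + y ^ 2))
            + (F₄ - η * fordSmoothW0 θ * (x₂ + δ) / ((x₂ + δ) ^ 2 + y ^ 2)))) := by
    ring
  rw [key]
  have hk3 : κ * ((F₃ - η * fordSmoothW0 θ * (x₁ + δ) / ((x₁ + δ) ^ 2 + y ^ 2))
      + (F₄ - η * fordSmoothW0 θ * (x₂ + δ) / ((x₂ + δ) ^ 2 + y ^ 2))) ≤ κ * (2 * E) := by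
    refine mul_le_mul_of_nonneg_left ?_ hκ
    linarith
  have hEκ : 2 * (1 + κ) * Mst * η ^ 2 / y ^ 2 = 2 * E + κ * (2 * E) := by rw [hE]; ring
  rw [hEκ]
  linarith

/-- Far zeros: the pair is `≥ −2(1+κ)M*η²/(t−γ)²` (`far_pair_ge`). [cite: Kadiri2005, Prop. 4.4] -/
theorem pairVal_far_ge (hθ : 0 < θ) (hθ' : θ < π / 2) (hη : 0 < η) {σ δ κ t₀ Mst β t γ : ℝ}
    (hσ : 1 / 2 < σ) (hσ1 : σ ≤ 1) (hδ : 0 ≤ δ) (hδσ : 2 * (1 - σ) ≤ δ) (hκ : 0 ≤ κ) (ht₀ : 1 ≤ t₀)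
    (hβ0 : 0 ≤ β) (hβ1 : β ≤ 1) (hy : t₀ ≤ |t - γ|)
    (hA : κ * (2 * σ - 1 + 2 * δ) ≤ 2 * σ - 1)
    (hSt : κ * (2 * σ - 1 + 2 * δ) * (-(1 - σ) + (2 * σ - 1) * δ + δ ^ 2 + t₀ ^ 2) ≤
      (2 * σ - 1) * (-(1 - σ) + t₀ ^ 2))
    (hM : ∀ x : ℝ, σ - 1 ≤ x → mtyM3 θ (x / η) * η ≤ Mst * t₀) :
    -(2 * (1 + κ) * Mst * η ^ 2 / (t - γ) ^ 2) ≤ KadiriZeroSum.pairVal θ η σ δ κ t β γ :=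
  far_pair_ge hθ hθ' hη hσ hσ1 hδ hδσ hκ ht₀ hβ0 hβ1 hy hA hSt hM

/-! ## The symmetrised zero sum and its lower bound -/

/-- **Kadiri's lower bound for the zero sum, with one kept zero** (§4.1, Props. 4.2 + 4.4, the
bookkeeping of (3.10)–(3.11)). At `s = σ + it` (`1/2 < σ ≤ 1`, `t ≥ 0`, `ζ ≠ 0` at `s` and
`s + δ`), for the test function `f = ηh(η·)`: if every zero with `|γ − t| < t₀` has
`1 − σ ≤ β ≤ σ`, the boundary inequality of Prop. 4.2 and the Stechkin condition at `(−(1−σ), t₀)`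
hold, `2(1−σ) ≤ δ`, and `M(x/η) ≤ M*` for `x ≥ σ − 1`, then for any zero `ρ₀ = β₀ + iγ₀` with
`|γ₀ − t| < t₀` and `β₀ > 1/2`,
`Σ_ρ m(ρ)[Re F(s−ρ) − κ Re F(s+δ−ρ)] ≥ pairVal(β₀, γ₀) − (1+κ) M* η² · 3B(t, t₀)`.
[cite: Kadiri2005, Props. 4.2, 4.4, (3.10)] -/
theorem lower_bound_kept (hθ : 0 < θ) (hθ' : θ < π / 2) (hη : 0 < η) {σ δ κ t t₀ Mst : ℝ}
    (hσ : 1 / 2 < σ) (hσ1 : σ ≤ 1) (ht : 0 ≤ t) (hδ : 0 ≤ δ) (hδσ : 2 * (1 - σ) ≤ δ) (hκ : 0 ≤ κ)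
    (ht₀ : 4 ≤ t₀)
    (hζ : riemannZeta ((σ : ℂ) + t * I) ≠ 0) (hζ' : riemannZeta (((σ + δ : ℝ) : ℂ) + t * I) ≠ 0)
    (hnear : ∀ ρ : Zeros, |(ρ : ℂ).im - t| < t₀ → 1 - σ ≤ (ρ : ℂ).re ∧ (ρ : ℂ).re ≤ σ)
    (hB : ∀ y : ℝ, κ * ((fordLaplace (kadiriTest θ η) ((δ : ℂ) + y * I)).re +
        (fordLaplace (kadiriTest θ η) (((2 * σ - 1 + δ : ℝ) : ℂ) + y * I)).re) ≤
      (fordLaplace (kadiriTest θ η) (((0 : ℝ) : ℂ) + y * I)).re +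
        (fordLaplace (kadiriTest θ η) (((2 * σ - 1 : ℝ) : ℂ) + y * I)).re)
    (hA : κ * (2 * σ - 1 + 2 * δ) ≤ 2 * σ - 1)
    (hSt : κ * (2 * σ - 1 + 2 * δ) * (-(1 - σ) + (2 * σ - 1) * δ + δ ^ 2 + t₀ ^ 2) ≤
      (2 * σ - 1) * (-(1 - σ) + t₀ ^ 2))
    (hM : ∀ x : ℝ, σ - 1 ≤ x → mtyM3 θ (x / η) * η ≤ Mst * t₀)
    (ρ₀ : Zeros) (hρ₀ : |(ρ₀ : ℂ).im - t| < t₀) (hβ₀ : 1 / 2 < (ρ₀ : ℂ).re) :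
    KadiriZeroSum.pairVal θ η σ δ κ t (ρ₀ : ℂ).re (ρ₀ : ℂ).im - (1 + κ) * Mst * η ^ 2 * (3 * KadiriTail.tailBound t t₀) ≤
      ∑' ρ : Zeros, (riemannZetaZeroOrder (ρ : ℂ) : ℝ) *
        ((fordLaplace (kadiriTest θ η) ((σ : ℂ) + t * I - ρ)).re -
          κ * (fordLaplace (kadiriTest θ η) (((σ + δ : ℝ) : ℂ) + t * I - ρ)).re) := by
  classical
  have hT := KadiriTest.isSmoothedEFTest hθ hθ' hη
  set s : ℂ := (σ : ℂ) + t * I with hs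
  set s' : ℂ := ((σ + δ : ℝ) : ℂ) + t * I with hs'
  -- the summand and its summability
  set g : Zeros → ℝ := fun ρ ↦ (riemannZetaZeroOrder (ρ : ℂ) : ℝ) *
    ((fordLaplace (kadiriTest θ η) (s - ρ)).re - κ * (fordLaplace (kadiriTest θ η) (s' - ρ)).re) with hg
  have hsum1 := SmoothedEF.summable_zeroOrder_mul_re_fordLaplace hT (s := s) (by simp [hs]; linarith) hζ
  have hsum2 := SmoothedEF.summable_zeroOrder_mul_re_fordLaplace hT (s := s') (by simp [hs']; linarith) hζ'
  have hsum_g : Summable g := by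
    refine (hsum1.sub (hsum2.mul_left κ)).congr fun ρ ↦ ?_
    simp only [hg]
    ring
  -- symmetrisation by `ρ ↦ 1 − ρ̄`
  have hsum_gr : Summable (g ∘ FordL33.refl) := (Equiv.summable_iff FordL33.reflEquiv).2 hsum_g
  have htsum_gr : ∑' ρ, (g ∘ FordL33.refl) ρ = ∑' ρ, g ρ := Equiv.tsum_eq FordL33.reflEquiv g
  set P : Zeros → ℝ := fun ρ ↦ g ρ + (g ∘ FordL33.refl) ρ with hP
  have hsum_P : Summable P := hsum_g.add hsum_gr
  have htsum_P : ∑' ρ, P ρ = 2 * ∑' ρ, g ρ := by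
    rw [hP, hsum_g.tsum_add hsum_gr, htsum_gr]
    ring
  -- `P ρ = m(ρ) · pairVal(β, γ)`
  have hP_eq : ∀ ρ : Zeros, P ρ = (riemannZetaZeroOrder (ρ : ℂ) : ℝ) * KadiriZeroSum.pairVal θ η σ δ κ t (ρ : ℂ).re (ρ : ℂ).im := by
    intro ρ
    have him : ((FordL33.refl ρ : Zeros) : ℂ).im = (ρ : ℂ).im := by simp [FordL33.refl]
    simp only [hP, hg, Function.comp_apply, FordL33.order_refl, hs, hs', KadiriZeroSum.sub_coe_eq, KadiriZeroSum.pairVal,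
      FordL33.refl_re, him]
    have e4 : σ - (1 - (ρ : ℂ).re) = σ - 1 + (ρ : ℂ).re := by ring
    have e5 : σ + δ - (1 - (ρ : ℂ).re) = σ + δ - 1 + (ρ : ℂ).re := by ring
    simp only [e4, e5]
    ring
  -- basic facts on zeros
  have hm0 : ∀ ρ : Zeros, (0 : ℝ) ≤ riemannZetaZeroOrder (ρ : ℂ) := fun ρ ↦ (FordL33.order_pos ρ).le
  have hm1 : ∀ ρ : Zeros, (1 : ℝ) ≤ riemannZetaZeroOrder (ρ : ℂ) := fun ρ ↦ by
    exact_mod_cast ZetaZeros.riemannZetaNontrivialZeros.one_le_order ρ.2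
  have hβ01 : ∀ ρ : Zeros, 0 ≤ (ρ : ℂ).re ∧ (ρ : ℂ).re ≤ 1 := fun ρ ↦
    ⟨(ZetaZeros.riemannZetaNontrivialZeros.re_pos ρ.2).le, (ZetaZeros.riemannZetaNontrivialZeros.re_lt_one ρ.2).le⟩
  -- pointwise lower bounds for the pair
  have hpair_near : ∀ ρ : Zeros, |(ρ : ℂ).im - t| < t₀ → 0 ≤ KadiriZeroSum.pairVal θ η σ δ κ t (ρ : ℂ).re (ρ : ℂ).im :=
    fun ρ hρ ↦ KadiriZeroSum.pairVal_nonneg hθ hθ' hη hσ hδ hκ hB (hnear ρ hρ)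
  have hpair_far : ∀ ρ : Zeros, t₀ ≤ |(ρ : ℂ).im - t| →
      -(2 * (1 + κ) * Mst * η ^ 2 / (t - (ρ : ℂ).im) ^ 2) ≤ KadiriZeroSum.pairVal θ η σ δ κ t (ρ : ℂ).re (ρ : ℂ).im := by
    intro ρ hρ
    have hy : t₀ ≤ |t - (ρ : ℂ).im| := by rwa [abs_sub_comm]
    exact pairVal_far_ge hθ hθ' hη hσ hσ1 hδ hδσ hκ (by linarith) (hβ01 ρ).1 (hβ01 ρ).2 hy hA hSt hM
  -- the minorant `L`
  set K₀ : ℝ := KadiriZeroSum.pairVal θ η σ δ κ t (ρ₀ : ℂ).re (ρ₀ : ℂ).im with hK₀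
  set C : ℝ := 2 * (1 + κ) * Mst * η ^ 2 with hC
  have hMst0 : 0 ≤ Mst := by
    have h1 : 0 ≤ Mst * t₀ := (mul_nonneg (KadiriThird.mtyM3_nonneg hθ hθ' _) hη.le).trans (hM σ (by linarith))
    exact (mul_nonneg_iff_of_pos_right (by linarith)).1 h1
  have hC0 : 0 ≤ C := by positivity
  set far : Zeros → ℝ := fun ρ ↦ if t₀ ≤ |(ρ : ℂ).im - t| then
      (riemannZetaZeroOrder (ρ : ℂ) : ℝ) / ((ρ : ℂ).im - t) ^ 2 else 0 with hfar
  set ind : Zeros → ℝ := fun ρ ↦ if ρ = ρ₀ ∨ ρ = FordL33.refl ρ₀ then 1 else 0 with hind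
  set L : Zeros → ℝ := fun ρ ↦ K₀ * ind ρ - C * far ρ with hL
  obtain ⟨hfar_sum, hfar_le⟩ := KadiriTail.summable_far_and_tsum_le ht ht₀
  -- the kept pair
  have hne : ρ₀ ≠ FordL33.refl ρ₀ := fun e ↦ by
    have := congrArg (fun ρ : Zeros ↦ (ρ : ℂ).re) e
    simp only [FordL33.refl_re] at this
    linarith
  have hK₀0 : 0 ≤ K₀ := hpair_near ρ₀ hρ₀
  have hind_zero : ∀ ρ ∉ ({ρ₀, FordL33.refl ρ₀} : Finset Zeros), ind ρ = 0 := by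
    intro ρ hρ
    simp only [Finset.mem_insert, Finset.mem_singleton, not_or] at hρ
    simp [hind, hρ.1, hρ.2]
  have hind_sum : Summable ind := summable_of_ne_finset_zero hind_zero
  have hind_tsum : ∑' ρ, ind ρ = 2 := by
    rw [tsum_eq_sum hind_zero, Finset.sum_pair hne]
    simp [hind]
    norm_num
  have hL_sum : Summable L := (hind_sum.mul_left K₀).sub (hfar_sum.mul_left C)
  have hL_tsum : ∑' ρ, L ρ = 2 * K₀ - C * ∑' ρ, far ρ := by
    rw [hL, (hind_sum.mul_left K₀).tsum_sub (hfar_sum.mul_left C), tsum_mul_left, tsum_mul_left,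
      hind_tsum]
    ring
  -- pointwise `L ≤ P`
  have hLP : ∀ ρ : Zeros, L ρ ≤ P ρ := by
    intro ρ
    rw [hP_eq ρ]
    simp only [hL, hind, hfar]
    by_cases hk : ρ = ρ₀ ∨ ρ = FordL33.refl ρ₀
    · -- kept: the pair equals `K₀ ≥ 0` and the multiplicity is `≥ 1`
      have hval : KadiriZeroSum.pairVal θ η σ δ κ t (ρ : ℂ).re (ρ : ℂ).im = K₀ := by
        rcases hk with h | h
        · rw [h]
        · rw [h, hK₀]
          have hre : ((FordL33.refl ρ₀ : Zeros) : ℂ).re = 1 - (ρ₀ : ℂ).re := FordL33.refl_re ρ₀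
          have him : ((FordL33.refl ρ₀ : Zeros) : ℂ).im = (ρ₀ : ℂ).im := by simp [FordL33.refl]
          rw [hre, him, KadiriZeroSum.pairVal_one_sub]
      have hnear' : |(ρ : ℂ).im - t| < t₀ := by
        rcases hk with h | h
        · rw [h]; exact hρ₀
        · rw [h]
          have him : ((FordL33.refl ρ₀ : Zeros) : ℂ).im = (ρ₀ : ℂ).im := by simp [FordL33.refl]
          rw [him]; exact hρ₀
      rw [if_pos hk, if_neg (not_le.2 hnear'), hval]
      have := hm1 ρ
      nlinarith [hK₀0]
    · rw [if_neg hk]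
      by_cases hfarρ : t₀ ≤ |(ρ : ℂ).im - t|
      · rw [if_pos hfarρ]
        have h1 := hpair_far ρ hfarρ
        have hy0 : ((ρ : ℂ).im - t) ^ 2 = (t - (ρ : ℂ).im) ^ 2 := by ring
        have hne0 : t - (ρ : ℂ).im ≠ 0 := fun e ↦ by
          rw [show (ρ : ℂ).im - t = -(t - (ρ : ℂ).im) by ring, e, neg_zero, abs_zero] at hfarρ
          linarith
        have hy2 : 0 < (t - (ρ : ℂ).im) ^ 2 := by positivity
        rw [hy0]
        have h2 := mul_le_mul_of_nonneg_left h1 (hm0 ρ)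
        have e : K₀ * 0 - C * ((riemannZetaZeroOrder (ρ : ℂ) : ℝ) / (t - (ρ : ℂ).im) ^ 2) =
            (riemannZetaZeroOrder (ρ : ℂ) : ℝ) * -(2 * (1 + κ) * Mst * η ^ 2 / (t - (ρ : ℂ).im) ^ 2) := by
          rw [hC]; field_simp; ring
        rw [e]
        exact h2
      · rw [if_neg hfarρ]
        simp only [mul_zero, sub_zero]
        exact mul_nonneg (hm0 ρ) (hpair_near ρ (not_le.1 hfarρ))
  -- conclude
  have key : ∑' ρ, L ρ ≤ ∑' ρ, P ρ := Summable.tsum_le_tsum hLP hL_sum hsum_P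
  rw [hL_tsum, htsum_P] at key
  have hfar' : C * ∑' ρ, far ρ ≤ C * (3 * KadiriTail.tailBound t t₀) :=
    mul_le_mul_of_nonneg_left hfar_le hC0
  have : K₀ - (1 + κ) * Mst * η ^ 2 * (3 * KadiriTail.tailBound t t₀) ≤ ∑' ρ, g ρ := by
    rw [hC] at hfar'
    nlinarith
  simpa [hg] using this

/-- **Kadiri's lower bound for the zero sum, no kept zero** (the points `σ + ikγ₀`, `k ≠ 1`, and
`k = 0`): under the hypotheses of `lower_bound_kept` (without a designated zero),
`Σ_ρ m(ρ)[Re F(s−ρ) − κ Re F(s+δ−ρ)] ≥ −(1+κ) M* η² · 3B(t, t₀)`.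
[cite: Kadiri2005, Props. 4.2, 4.4] -/
theorem lower_bound (hθ : 0 < θ) (hθ' : θ < π / 2) (hη : 0 < η) {σ δ κ t t₀ Mst : ℝ}
    (hσ : 1 / 2 < σ) (hσ1 : σ ≤ 1) (ht : 0 ≤ t) (hδ : 0 ≤ δ) (hδσ : 2 * (1 - σ) ≤ δ) (hκ : 0 ≤ κ)
    (ht₀ : 4 ≤ t₀)
    (hζ : riemannZeta ((σ : ℂ) + t * I) ≠ 0) (hζ' : riemannZeta (((σ + δ : ℝ) : ℂ) + t * I) ≠ 0)
    (hnear : ∀ ρ : Zeros, |(ρ : ℂ).im - t| < t₀ → 1 - σ ≤ (ρ : ℂ).re ∧ (ρ : ℂ).re ≤ σ)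
    (hB : ∀ y : ℝ, κ * ((fordLaplace (kadiriTest θ η) ((δ : ℂ) + y * I)).re +
        (fordLaplace (kadiriTest θ η) (((2 * σ - 1 + δ : ℝ) : ℂ) + y * I)).re) ≤
      (fordLaplace (kadiriTest θ η) (((0 : ℝ) : ℂ) + y * I)).re +
        (fordLaplace (kadiriTest θ η) (((2 * σ - 1 : ℝ) : ℂ) + y * I)).re)
    (hA : κ * (2 * σ - 1 + 2 * δ) ≤ 2 * σ - 1)
    (hSt : κ * (2 * σ - 1 + 2 * δ) * (-(1 - σ) + (2 * σ - 1) * δ + δ ^ 2 + t₀ ^ 2) ≤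
      (2 * σ - 1) * (-(1 - σ) + t₀ ^ 2))
    (hM : ∀ x : ℝ, σ - 1 ≤ x → mtyM3 θ (x / η) * η ≤ Mst * t₀) :
    -((1 + κ) * Mst * η ^ 2 * (3 * KadiriTail.tailBound t t₀)) ≤
      ∑' ρ : Zeros, (riemannZetaZeroOrder (ρ : ℂ) : ℝ) *
        ((fordLaplace (kadiriTest θ η) ((σ : ℂ) + t * I - ρ)).re -
          κ * (fordLaplace (kadiriTest θ η) (((σ + δ : ℝ) : ℂ) + t * I - ρ)).re) := by
  classical
  have hT := KadiriTest.isSmoothedEFTest hθ hθ' hη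
  set s : ℂ := (σ : ℂ) + t * I with hs
  set s' : ℂ := ((σ + δ : ℝ) : ℂ) + t * I with hs'
  set g : Zeros → ℝ := fun ρ ↦ (riemannZetaZeroOrder (ρ : ℂ) : ℝ) *
    ((fordLaplace (kadiriTest θ η) (s - ρ)).re - κ * (fordLaplace (kadiriTest θ η) (s' - ρ)).re) with hg
  have hsum1 := SmoothedEF.summable_zeroOrder_mul_re_fordLaplace hT (s := s) (by simp [hs]; linarith) hζ
  have hsum2 := SmoothedEF.summable_zeroOrder_mul_re_fordLaplace hT (s := s') (by simp [hs']; linarith) hζ'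
  have hsum_g : Summable g := by
    refine (hsum1.sub (hsum2.mul_left κ)).congr fun ρ ↦ ?_
    simp only [hg]
    ring
  have hsum_gr : Summable (g ∘ FordL33.refl) := (Equiv.summable_iff FordL33.reflEquiv).2 hsum_g
  have htsum_gr : ∑' ρ, (g ∘ FordL33.refl) ρ = ∑' ρ, g ρ := Equiv.tsum_eq FordL33.reflEquiv g
  set P : Zeros → ℝ := fun ρ ↦ g ρ + (g ∘ FordL33.refl) ρ with hP
  have hsum_P : Summable P := hsum_g.add hsum_gr
  have htsum_P : ∑' ρ, P ρ = 2 * ∑' ρ, g ρ := by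
    rw [hP, hsum_g.tsum_add hsum_gr, htsum_gr]
    ring
  have hP_eq : ∀ ρ : Zeros, P ρ = (riemannZetaZeroOrder (ρ : ℂ) : ℝ) * KadiriZeroSum.pairVal θ η σ δ κ t (ρ : ℂ).re (ρ : ℂ).im := by
    intro ρ
    have him : ((FordL33.refl ρ : Zeros) : ℂ).im = (ρ : ℂ).im := by simp [FordL33.refl]
    simp only [hP, hg, Function.comp_apply, FordL33.order_refl, hs, hs', KadiriZeroSum.sub_coe_eq, KadiriZeroSum.pairVal,
      FordL33.refl_re, him]
    have e4 : σ - (1 - (ρ : ℂ).re) = σ - 1 + (ρ : ℂ).re := by ring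
    have e5 : σ + δ - (1 - (ρ : ℂ).re) = σ + δ - 1 + (ρ : ℂ).re := by ring
    simp only [e4, e5]
    ring
  have hm0 : ∀ ρ : Zeros, (0 : ℝ) ≤ riemannZetaZeroOrder (ρ : ℂ) := fun ρ ↦ (FordL33.order_pos ρ).le
  have hβ01 : ∀ ρ : Zeros, 0 ≤ (ρ : ℂ).re ∧ (ρ : ℂ).re ≤ 1 := fun ρ ↦
    ⟨(ZetaZeros.riemannZetaNontrivialZeros.re_pos ρ.2).le, (ZetaZeros.riemannZetaNontrivialZeros.re_lt_one ρ.2).le⟩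
  have hpair_near : ∀ ρ : Zeros, |(ρ : ℂ).im - t| < t₀ → 0 ≤ KadiriZeroSum.pairVal θ η σ δ κ t (ρ : ℂ).re (ρ : ℂ).im :=
    fun ρ hρ ↦ KadiriZeroSum.pairVal_nonneg hθ hθ' hη hσ hδ hκ hB (hnear ρ hρ)
  have hpair_far : ∀ ρ : Zeros, t₀ ≤ |(ρ : ℂ).im - t| →
      -(2 * (1 + κ) * Mst * η ^ 2 / (t - (ρ : ℂ).im) ^ 2) ≤ KadiriZeroSum.pairVal θ η σ δ κ t (ρ : ℂ).re (ρ : ℂ).im := by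
    intro ρ hρ
    have hy : t₀ ≤ |t - (ρ : ℂ).im| := by rwa [abs_sub_comm]
    exact pairVal_far_ge hθ hθ' hη hσ hσ1 hδ hδσ hκ (by linarith) (hβ01 ρ).1 (hβ01 ρ).2 hy hA hSt hM
  set C : ℝ := 2 * (1 + κ) * Mst * η ^ 2 with hC
  have hMst0 : 0 ≤ Mst := by
    have h1 : 0 ≤ Mst * t₀ := (mul_nonneg (KadiriThird.mtyM3_nonneg hθ hθ' _) hη.le).trans (hM σ (by linarith))
    exact (mul_nonneg_iff_of_pos_right (by linarith)).1 h1
  have hC0 : 0 ≤ C := by positivity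
  set far : Zeros → ℝ := fun ρ ↦ if t₀ ≤ |(ρ : ℂ).im - t| then
      (riemannZetaZeroOrder (ρ : ℂ) : ℝ) / ((ρ : ℂ).im - t) ^ 2 else 0 with hfar
  set L : Zeros → ℝ := fun ρ ↦ -(C * far ρ) with hL
  obtain ⟨hfar_sum, hfar_le⟩ := KadiriTail.summable_far_and_tsum_le ht ht₀
  have hL_sum : Summable L := (hfar_sum.mul_left C).neg
  have hL_tsum : ∑' ρ, L ρ = -(C * ∑' ρ, far ρ) := by
    rw [hL, tsum_neg, tsum_mul_left]
  have hLP : ∀ ρ : Zeros, L ρ ≤ P ρ := by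
    intro ρ
    rw [hP_eq ρ]
    simp only [hL, hfar]
    by_cases hfarρ : t₀ ≤ |(ρ : ℂ).im - t|
    · rw [if_pos hfarρ]
      have h1 := hpair_far ρ hfarρ
      have hy0 : ((ρ : ℂ).im - t) ^ 2 = (t - (ρ : ℂ).im) ^ 2 := by ring
      have hne0 : t - (ρ : ℂ).im ≠ 0 := fun e ↦ by
        rw [show (ρ : ℂ).im - t = -(t - (ρ : ℂ).im) by ring, e, neg_zero, abs_zero] at hfarρ
        linarith
      have hy2 : 0 < (t - (ρ : ℂ).im) ^ 2 := by positivity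
      rw [hy0]
      have h2 := mul_le_mul_of_nonneg_left h1 (hm0 ρ)
      have e : -(C * ((riemannZetaZeroOrder (ρ : ℂ) : ℝ) / (t - (ρ : ℂ).im) ^ 2)) =
          (riemannZetaZeroOrder (ρ : ℂ) : ℝ) * -(2 * (1 + κ) * Mst * η ^ 2 / (t - (ρ : ℂ).im) ^ 2) := by
        rw [hC]; field_simp
      rw [e]
      exact h2
    · rw [if_neg hfarρ]
      simp only [mul_zero, neg_zero]
      exact mul_nonneg (hm0 ρ) (hpair_near ρ (not_le.1 hfarρ))
  have key : ∑' ρ, L ρ ≤ ∑' ρ, P ρ := Summable.tsum_le_tsum hLP hL_sum hsum_P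
  rw [hL_tsum, htsum_P] at key
  have hfar' : C * ∑' ρ, far ρ ≤ C * (3 * KadiriTail.tailBound t t₀) :=
    mul_le_mul_of_nonneg_left hfar_le hC0
  have : -((1 + κ) * Mst * η ^ 2 * (3 * KadiriTail.tailBound t t₀)) ≤ ∑' ρ, g ρ := by
    rw [hC] at hfar'
    nlinarith
  simpa [hg] using this

end KadiriZeroSum3

end Literature.NumberTheory.LFunctions
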